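import Summits.BirchSwinnertonDyer.Rank1Residual.F1Sign2.TwistLatticeAtTwo
import Literature.NumberTheory.EllipticCurves.CongruenceNumber
import Literature.NumberTheory.EllipticCurves.ModularSymbolsLattice
import Literature.NumberTheory.EllipticCurves.Selmer
import Literature.NumberTheory.EllipticCurves.QuadraticTwist
import HarnessLib.Audit.Tags
import HarnessLib

/-!
# ES-34 «THE 2-ADIC FLOOR OF THE MODULAR DEGREE IS THE ANATOMY OF THE ADJOINT L-VALUE» (-es g25; typer -ty g22 port of the crux workfile
# `Cruxes/RankOneAtTwoBigImageOddLocal/SymSquareAnatomyES34.lean` v2 9333133fa4de8611)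

PORT (typer -ty g22; -es g25 RESULT 04:25Z + ADDENDUM 2 04:41Z «-ty: port v2»): NEW sibling of `TwistLatticeAtTwo.lean` (ES-33), same layout: -es's namespace
`Summit.BirchSwinnertonDyer.BirchSwinnertonDyer.Theorems.RankOneAtTwoSymSquareAnatomy`, carriers (`inertiaOrderAt`, `symSquareSignAt`, `torusUnitAt`, `localDegreeUnit`,
`oddUnitSum`, `twoAdicDegreeUnit`, `twoAdicCongruenceUnit`, `IsTwistMinimal`, `oddTwistShift`) and rows VERBATIM, riders appended; tags as -es set them EXCEPT the v1 row
ES-34U `MotivicEulerFactorFloor` (`m`-currency), which -es REFUTED IN DATA itself (addendum 2, witness 6962e1) — ported PLAIN as a typed NEGATIVE (not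
`@[conjecture]`: a refuted statement is not an open obligation; precedent `HalvedGenusPointFirstLayerAtTwo`); its `r`-currency twin ES-34U♯
`MotivicEulerFactorCongruenceFloor` (v1, unrefuted, superseded) and the repaired forms ES-34U-R `MotivicEulerFactorFloorR` / `MotivicEulerFactorCongruenceFloorR`
keep -es's `@[conjecture]`; ES-34V `OddTwistModularDegreeShift` PLAIN (print, `m`-currency), ES-34W `OddTwistCongruenceNumberShift` and ES-34T
`ARSDefectOfSemistableTwistAtSixteen` `@[conjecture]`.  DOCFIX (typer; cite-tag SHAPE only — one key per bracket and only keys present in `references.bib`; every locator kept verbatim, none invented; no wording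
change; statements untouched): key `Watkins2002ModularDegree` → `Watkins2002` (Experiment. Math. 11 (2002); 7 tags: the local-units block, ES-34U, U♯, U-R, V, W, T);
`Flach1993` → `Flach1992` (Invent. Math. 109 (1992) — the bib's key for the workfile's «Flach 1993»; ES-34U); `Zagier1985ModularParametrizations` → `Zagier1985` (ES-34V);
`CornellSilvermanStevens1997FLT, p. 435 …` → `deShalit1997, p. 435 …` (de Shalit's chapter = pp. 421–445 of Cornell–Silverman–Stevens, the bib's home of p. 435; ES-34W);
every multi-key bracket `K1, loc; K2` split into one bracket per key (ES-34U, U♯, V, W, T).  The glue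
theorems (`motivicEulerFactorFloorR_of_v1`, `motivicEulerFactorCongruenceFloorR_of_v1`, `twoAdicDegreeUnit_le_congruenceUnit`, `localDegreeUnit_of_not_sq_dvd`,
`one_le_torusUnitAt`) are in the kernel sibling `…SymSquareAnatomyAtTwoKernel.lean`.  REF1 audit: PENDING at port time (REF1 g23 FINAL 04:29Z; the successor's gate +
A1–A6 audit are owed — any kill ⟹ a v2 of this file under new names, never an in-place edit); REF2 placement owed.  Nothing here is asserted; BSD is not proved;
23715 is not closed.

v2 (typer -ty g22, after REF1 g24 §319 = A1–A6+BC7 audit of the same workfile v2, posted 04:53Z — three minutes after this file landed as p761471; riders R319a–f;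
evidence `REF1-data/b319/`, probe `Probe319.lean` 218d7a06bd7a7aaf): REF1 verdicts — U-R `MotivicEulerFactorFloorR`, U♯-R `MotivicEulerFactorCongruenceFloorR`, W
`OddTwistCongruenceNumberShift`, T `ARSDefectOfSemistableTwistAtSixteen` SURVIVE as `@[conjecture]` (censuses reproduced exactly by an independent re-tally from the typed
units: 13 995 / 1 045 / 0 / 201; 2 227 / 119 / 0; 1 276 / 0; 273 / 273) — unchanged here; the v1 PAIR is KILLED IN DATA (U v1 by 6962e1 as -es said; U♯ v1 TOO, new: same
witness via Agashe–Ribet–Stein Thm 2.1, K319.7) ⟹ per R319f («only as tombstones, never `@[conjecture]` on a row refuted in data») and the tree rule «append-only: deprecate,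
don't mutate» BOTH v1 declarations are KEPT VERBATIM as `@[deprecated]` TOMBSTONES (U v1: attribute added to the PLAIN negative; U♯ v1: `@[conjecture]` replaced by
`@[deprecated]`; precedent `DefiniteMod2WaldspurgerAtTwo.lean` v4), and the two `…R_of_v1` glue theorems are withdrawn IN PLACE in the kernel (kept verbatim,
themselves `@[deprecated]` — the same append-only rule; a kernel v2 dropping them bounced `theorems.append-only` at preflight); V `OddTwistModularDegreeShift` SURVIVES IN DATA but is
print ⊕ Manin (R319c) ⟹ RETAGGED `@[conjecture]` (attribute added, body verbatim) AND REF1's print-literal Manin-displayed form K319.8 `OddTwistModularDegreeShiftManin` APPENDED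
right after it (PLAIN; VERBATIM from `Probe319.lean`, REF1's docstring kept, typer rider); errata R319a (U-docstring: `p = 17`, `λ = 4` is type III) and R319b (workfile header
below: «`L^A = L^M · ∏_{p² ∣ N} U_p(s)`» has the product on the wrong side — Watkins p. 491: `L^A_p ≡ 1`, `L^M_p = U_p` at additive `p`, so `L^M = L^A · ∏_{p² ∣ N} U_p`; the
U-docstring's reading `v₂(N c² L^M(2)/(πiΩ)/∏p) ≥ …` is nevertheless consistent) are recorded as riders — -es's sentences stay verbatim; R319d (companion «good → 2⁶, d = 3» is
S₃-only) concerns an untyped remark; R319e (junk-0 currencies `Nat.card (W.selmerGroup 2)` / `congruenceNumber`, weaken only) as in ES-32/33.  Kernel v2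
(`…SymSquareAnatomyAtTwoKernel.lean`): -es's three unit lemmas + REF1's §319 probe block K319.1–K319.8 (tables, residue law, λ-examples, `torusUnitAt_eq`, the 6962e1
arithmetic, Manin glue).  No decl removed, no body changed; nothing asserted; BSD not proved; 23715 not closed.

WORKFILE HEADER (-es g25, VERBATIM):

# ES-34 (-es g25) — the 2-adic floor of the modular degree is the ANATOMY OF THE ADJOINT L-VALUE
# (sketch; crux `RankOneAtTwoBigImageOddLocal` = stmt-BirchSwinnertonDyer-23715)

PRINT (m-currency).  Watkins, *Computing the modular degree of an elliptic curve*, Experiment. Math. 11 (2002),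
(1-1) and §2 [corpus:paper:doi-10-1080-10586458-2002-10504701 p2, p5–7] (Flach 1993, Shimura 1976, Zagier 1985,
Coates–Schmidt 1987): `deg φ_E = N c² L^A(Sym² E, 2)/(π i Ω_E)` with `L^A = L^M · ∏_{p² ∣ N} U_p(s)`; under a quadratic
twist `E = F ⊗ χ`, `deg φ_E = deg φ_F (c_E/c_F)² ∏_p V_p` with, at an odd `p ∣ cond χ`: `V_p = (p−1)(p+1−a_p)(p+1+a_p)`
(`F` good at `p`), `(p−1)(p+1)` (`F` multiplicative), `p` (`F` additive); at a twist-MINIMAL additive `p ≥ 5`: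
`U_p(2)⁻¹ = (p − ε'_p)/p` with `ε'_p = +1` iff `ℚ_p(F[3])/ℚ_p` is abelian (Thm 2.1 / Cor 2.2).
DATA (ENGINE 34 = pure-integer pass over the -es g23/g24 tables: 38 042 optimal curves `N ≤ 10⁴` with `deg`, `dim Sel₂`,
local data; 6 549 with the congruence number `r`): the twist formula is EXACT in `v₂(deg)` on 16 360 / 16 360 pairs;
the new laws below are what is NOT in print.  Currency: `m` = modular degree of the optimal curve, `r` = congruence number
of the newform.  Nothing here is a theorem beyond print; BSD is not proved.
-/

open scoped Classical AddSubgroup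

noncomputable section

set_option linter.dupNamespace false
set_option autoImplicit false

namespace Summit.BirchSwinnertonDyer.BirchSwinnertonDyer.Theorems.RankOneAtTwoSymSquareAnatomy

open Literature.NumberTheory.EllipticCurves Literature.NumberTheory.EllipticCurves.ModularForms WeierstrassCurve
open Summit.BirchSwinnertonDyer.BirchSwinnertonDyer.Theorems.RankOneAtTwoTwistLattice (primeCount primeStar)

/-! ## The local units -/

/-- The order `e_p = 12 / gcd(12, v_p(Δ_min))` of the inertia image at a prime `p ≥ 5` of additive, potentially good
reduction of a GLOBALLY MINIMAL `W` (Serre 1972 §5.6); `e_p ∈ {3, 4, 6}` exactly when `W` is `p`-twist-minimal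
(Kodaira `IV, III, II`). [cite: Serre1972, §5.6]
(carrier, VERBATIM from -es g25's crux workfile `SymSquareAnatomyES34.lean` v2 9333133fa4de8611; typer -ty g22.) -/
def inertiaOrderAt (W : WeierstrassCurve ℚ) (p : ℕ) : ℕ := 12 / Nat.gcd 12 (padicValRat p W.Δ).toNat

/-- Watkins' sign `ε'_p ∈ {+1, −1}` of the motivic Euler factor `L^M_p(Sym² E, s) = (1 − ε'_p p^{1−s})⁻¹` at a twist-minimal
additive prime `p ≥ 5`: `ε'_p = +1` iff `ℚ_p(E[3])/ℚ_p` is abelian iff `μ_{e_p} ⊂ ℚ_p` iff `p ≡ 1 (mod e_p)`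
(Watkins 2002 Thm 2.1; the elementary form Cor. 2.2: `p ≡ 1 (12)`: `+1`; `p ≡ 11 (12)`: `−1`; `p ≡ 5 (12)`: `+1` iff
`p² ∣ c₆ ∧ p ∥ c₄`; `p ≡ 7 (12)`: `−1` iff `p² ∣ c₆ ∧ p ∥ c₄`).  [cite: Watkins2002, Thm 2.1, Cor 2.2]
(carrier, VERBATIM from -es g25's crux workfile `SymSquareAnatomyES34.lean` v2 9333133fa4de8611; typer -ty g22.) -/
def symSquareSignAt (W : WeierstrassCurve ℚ) (p : ℕ) : ℤ := if p % inertiaOrderAt W p = 1 then 1 else -1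

/-- The TORUS UNIT `λ_p(W) = v₂(p − ε'_p(W)) = v₂(p · U_p(2)⁻¹)` of a twist-minimal additive prime `p ≥ 5`
(`= v₂(#T(𝔽_p))` for the one-dimensional torus `T` split iff `μ_{e_p} ⊂ 𝔽_p`).
(carrier, VERBATIM from -es g25's crux workfile `SymSquareAnatomyES34.lean` v2 9333133fa4de8611; typer -ty g22.) -/
def torusUnitAt (W : WeierstrassCurve ℚ) (p : ℕ) : ℕ :=
  if symSquareSignAt W p = 1 then padicValNat 2 (p - 1) else padicValNat 2 (p + 1)

/-- The local `2`-adic degree unit `λ_p` of an ODD prime `p ∣ N`: `1` at a multiplicative prime (the Atkin–Lehner unit);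
at `p = 3` additive: `2` if `v₃(N) = 2` (`U₃(2) = 3/4`, Watkins §2.2.2) else `1`; at an additive `p ≥ 5`: the torus unit.
(carrier, VERBATIM from -es g25's crux workfile `SymSquareAnatomyES34.lean` v2 9333133fa4de8611; typer -ty g22.) -/
def localDegreeUnit (W : WeierstrassCurve ℚ) (N p : ℕ) : ℕ :=
  if ¬ p ^ 2 ∣ N then 1 else if p = 3 then (if ¬ 3 ^ 3 ∣ N then 2 else 1) else torusUnitAt W p

/-- `Λ_odd(W) = Σ_{p ∣ N, p odd} λ_p(W)`.
(carrier, VERBATIM from -es g25's crux workfile `SymSquareAnatomyES34.lean` v2 9333133fa4de8611; typer -ty g22.) -/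
def oddUnitSum (W : WeierstrassCurve ℚ) (N : ℕ) : ℕ :=
  ∑ p ∈ N.primeFactors.filter (fun p => p ≠ 2), localDegreeUnit W N p

/-- The `2`-adic unit of the modular-degree floor as a function of `v = v₂(N)`: `0, 1, 0, 2, 2, 3, 3, 4, 4` for `v = 0 … 8`
(`[2 ∣ N] + g(v)` with `g = ⌈v/2⌉ − 1` for `v ≥ 3` and the dip allowance `g(2) = −1`; ES-32 B♯ / ES-33E).
(carrier, VERBATIM from -es g25's crux workfile `SymSquareAnatomyES34.lean` v2 9333133fa4de8611; typer -ty g22.) -/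
def twoAdicDegreeUnit (v : ℕ) : ℕ := if v = 0 ∨ v = 2 then 0 else if v = 1 then 1 else (v + 1) / 2

/-- The `2`-adic unit of the CONGRUENCE-NUMBER floor: `0, 1, 1, 3, 4, 5, 6, 7, 8` for `v = 0 … 8` (`[2 ∣ N] + (v − 1)` for
`v ≥ 3`, no dip; ES-33E `CongruenceNumberConductorFloor`).
(carrier, VERBATIM from -es g25's crux workfile `SymSquareAnatomyES34.lean` v2 9333133fa4de8611; typer -ty g22.) -/
def twoAdicCongruenceUnit (v : ℕ) : ℕ := if v = 0 then 0 else if v ≤ 2 then 1 else v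

/-- `W` is (globally) twist-minimal: no quadratic twist has smaller conductor.
(carrier, VERBATIM from -es g25's crux workfile `SymSquareAnatomyES34.lean` v2 9333133fa4de8611; typer -ty g22.) -/
def IsTwistMinimal (W : WeierstrassCurve ℚ) [W.IsElliptic] : Prop :=
  ∀ (d : ℚ) [(W.quadraticTwist d).IsElliptic], W.conductorNorm ℤ ≤ (W.quadraticTwist d).conductorNorm ℤ

/-! ## ES-34U — the motivic Euler factor floor (conjecture; -es g25 P34.7, CONFIRMED 820/822, the 2 exceptions have an odd isogeny) -/

/-- **ES-34U `MotivicEulerFactorFloor` — v1, REFUTED IN DATA as typed (the seat's own mutation pass, -es g25 addendum: the STARRED tie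
partner `6962e1`, see `MotivicEulerFactorFloorR` below, which supersedes it; kept as the recorded negative).**  For an optimal, twist-minimal, non-CM
`E/ℚ` with `ρ̄_{E,2}` surjective and no odd-degree rational isogeny,
`v₂(m_E) + 1 ≥ dim_{𝔽₂} Sel₂(E) + u₂(v₂ N) + Σ_{p ∣ N odd} λ_p(E)`:
the Atkin–Lehner term `ω(N) − 1` of the ES-32/33 floor is NOT flat — a twist-minimal additive prime `p ≥ 5` contributes
`λ_p = v₂(p − ε'_p)`, the `2`-part of the inverse MOTIVIC Euler factor `p·U_p(2)⁻¹ = p − ε'_p` of `L(Sym² E, s)` at `s = 2`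
(e.g. `+4` at `p = 17` of Kodaira type `II`/`IV`, `+5` at `p = 31` of type `III`).  ENGINE 34 (N ≤ 10⁴, 14 097 twist-minimal
`S₃`-curves, 822 with `Σ(λ_p − 1) > 0`): 820 satisfy it, 188 with equality; the 2 exceptions `338a1` (`7`-isogeny), `1058c1`
(`3`-isogeny) are excluded by the isogeny hypothesis; multiplicative primes stay flat (`λ_p = 1` for every `p mod 8`, `w_p`).
Why it might fail: a twist-minimal curve beyond `10⁴` with `v₂(m_E) + 1 − s − u₂ − Σλ_p < 0`, most plausibly at a prime
`p ≡ ±1 (mod 32)`; or the isogeny guard is not the right one (only 2 witnesses).  Reading: `v₂(N c² L^M(Sym² E,2)/(π i Ω_E) /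
∏_{p² ∣ N} p) ≥ dim Sel₂(E) + …` — integrality of the motivic adjoint `L`-value at `2` with its Bloch–Kato Selmer term
(Flach's theorem is prime-to-`2`; open at `2`). [cite: Watkins2002, (1-1), Thm 2.1] [cite: Flach1992]
(RIDER, typer -ty g22: PLAIN — a typed NEGATIVE, NOT `@[conjecture]` (the workfile's tag is dropped: -es g25 REFUTED this v1 row IN DATA
itself, ADDENDUM 2 2026-08-30T04:41:55Z, witness 6962e1 — `N = 2·59²`, Kodaira `IV*` at `59`, rank `0`, `Ш_an = 4`, `dim Sel₂ = 2`, `λ₅₉ = 2`, `v₂(m) = 3`: `4 < 5`;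
CensusES34 §7; a refuted statement is not an open obligation — precedent `HalvedGenusPointFirstLayerAtTwo`); kept VERBATIM as the record that the kernel glue
`Kernel.motivicEulerFactorFloorR_of_v1` and the census history refer to — never to be assumed; superseded by `MotivicEulerFactorFloorR` below. REF1-successor audit (REF1 g23 FINAL 04:29Z; -es: «audit the R decls, not v1») and REF2 placement owed at port time.)
(v2 TOMBSTONE, typer -ty g22 after REF1 g24 §319, 04:53Z: REF1 K319.7 reproduces the kill (1 / 15 218); R319f «the v1 pair only as tombstones — never `@[conjecture]` on a row
refuted in data»; tree rule «append-only: deprecate, don't mutate» ⟹ the declaration is KEPT VERBATIM and now carries `@[deprecated]` (precedent: the v4 tombstones of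
`DefiniteMod2WaldspurgerAtTwo.lean`); the kernel glue `motivicEulerFactorFloorR_of_v1` is withdrawn with it (kernel v2: kept verbatim, `@[deprecated]`).  ERRATUM R319a (REF1, cosmetic, on -es's sentence
above, which stays verbatim): «`+4` at `p = 17` of Kodaira type `II`/`IV`» should read type `III` (`e = 4`, `17 ≡ 1 (4)`, sign `+`, `λ = v₂ 16 = 4`); types `II`/`IV` at `17`
give sign `−` and `λ = v₂ 18 = 1` (kernel K319.4).  Do not use.) -/
@[deprecated "withdrawn (refuted in data as typed): -es g25 ADDENDUM 2 and REF1 g24 §319 K319.7 — starred tie partner 6962e1 (N = 2·59², IV* at 59, dim Sel₂ = 2, λ₅₉ = 2, v₂ m = 3: 32 > 16); repaired as MotivicEulerFactorFloorR (non-starred representative)" (since := "2026-08-30")]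
def MotivicEulerFactorFloor : Prop :=
  ∀ (W : WeierstrassCurve ℚ) [W.IsElliptic] [W.IsGloballyMinimal] [NeZero (W.conductorNorm ℤ)]
    (D : ModularParametrizationData W (W.conductorNorm ℤ)),
    (∀ (W'' : WeierstrassCurve ℚ) [W''.IsElliptic] (D'' : ModularParametrizationData W'' (W.conductorNorm ℤ)),
        D''.f = D.f → D.modularDegree ≤ D''.modularDegree) →
    ¬ W.HasCM → W.HasSurjectiveModNGaloisRep ((2 : ℕ) : ℤ) →
    (∀ ℓ : ℕ, ℓ.Prime → ℓ ≠ 2 → W.HasIrreducibleModPGaloisRep ℓ) → IsTwistMinimal W →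
    Nat.card (W.selmerGroup 2) *
        2 ^ (twoAdicDegreeUnit (padicValNat 2 (W.conductorNorm ℤ)) + oddUnitSum W (W.conductorNorm ℤ))
      ≤ 2 * 2 ^ padicValNat 2 D.modularDegree

/-- **ES-34U♯ `MotivicEulerFactorCongruenceFloor` — v1 (conductor-minimal only; superseded by `MotivicEulerFactorCongruenceFloorR`:
no `r`-currency violation is known on starred partners (49 with `r`), but the `m`-currency witness `6962e1` makes the unstarred
hypothesis the honest one).**  Same law for
the congruence number with the dip-free, linear `2`-adic unit of ES-33E: `v₂(r_E) + 1 ≥ dim Sel₂(E) + u₂ʳ(v₂ N) + Σ_{p odd} λ_p(E)`.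
ENGINE 34: 2 403 twist-minimal `S₃`-curves with `r` known, 2 exceptions = the same two isogenous curves.
Why it might fail: as ES-34U, plus the `v − 1` growth of the `2`-adic unit beyond `N ≤ 10⁴`. [cite: Watkins2002] [cite: AgasheRibetStein2012]
(RIDER, typer -ty g22: `@[conjecture]` as -es set it — v1, `r`-currency, UNREFUTED in data (no `r`-violation known) but SUPERSEDED by
`MotivicEulerFactorCongruenceFloorR` below (kernel glue `Kernel.motivicEulerFactorCongruenceFloorR_of_v1`); VERBATIM. REF1-successor audit (REF1 g23 FINAL 04:29Z; -es: «audit the R decls, not v1») and REF2 placement owed at port time.)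
(v2 TOMBSTONE, typer -ty g22 after REF1 g24 §319, 04:53Z: **KILLED IN DATA + PRINT** — supersedes the «UNREFUTED / no `r`-violation known» above: the U v1 witness 6962e1 has
`ord₂ N = 1`, so `v₂ r = v₂ m = 3` by Agashe–Ribet–Stein Thm 2.1 [cite: AgasheRibetStein2012, Thm 2.1], while the row needs `v₂ r ≥ dim Sel₂ + u₂ʳ(1) + λ₅₉ − 1 = 4`
(kernel K319.7: `2²·2^(1+2) = 32 > 16 = 2·2³`); R319f ⟹ `@[conjecture]` replaced by `@[deprecated]`, declaration KEPT VERBATIM as a tombstone (append-only rule; precedent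
`DefiniteMod2WaldspurgerAtTwo.lean` v4); the kernel glue `motivicEulerFactorCongruenceFloorR_of_v1` is withdrawn with it (kernel v2: kept verbatim, `@[deprecated]`).  Repaired row: `MotivicEulerFactorCongruenceFloorR`.  Do not use.) -/
@[deprecated "withdrawn (refuted in data as typed): REF1 g24 §319 K319.7 — the same witness 6962e1 refutes the r-currency row, since ord₂ N = 1 forces v₂ r = v₂ m = 3 (Agashe–Ribet–Stein Thm 2.1) while the row needs v₂ r ≥ 4; repaired as MotivicEulerFactorCongruenceFloorR" (since := "2026-08-30")]
def MotivicEulerFactorCongruenceFloor : Prop :=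
  ∀ (W : WeierstrassCurve ℚ) [W.IsElliptic] [W.IsGloballyMinimal] [NeZero (W.conductorNorm ℤ)]
    (D : ModularParametrizationData W (W.conductorNorm ℤ)),
    ¬ W.HasCM → W.HasSurjectiveModNGaloisRep ((2 : ℕ) : ℤ) →
    (∀ ℓ : ℕ, ℓ.Prime → ℓ ≠ 2 → W.HasIrreducibleModPGaloisRep ℓ) → IsTwistMinimal W →
    Nat.card (W.selmerGroup 2) *
        2 ^ (twoAdicCongruenceUnit (padicValNat 2 (W.conductorNorm ℤ)) + oddUnitSum W (W.conductorNorm ℤ))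
      ≤ 2 * 2 ^ padicValNat 2 (congruenceNumber D.f)

/-! ### ES-34U-R — the representative matters (addendum, -es g25): the law is read on the NON-STARRED member of each tie

Every curve with an additive `p ≥ 5` of Kodaira type `II, III, IV, IV*, III*, II*` has the conductor-tie twist partner `E ⊗ χ_{p*}`
(`II ↔ IV*`, `III ↔ III*`, `IV ↔ II*`): same `N`, same `v₂(m)` (Watkins `V_p = p`), same `λ_p` (`Sym²` is twist-invariant), but a
different `2`-Selmer group.  ENGINE 34 tested Sage's minimal twist, which is ALWAYS the non-starred member (`v_p(Δ_min) < 6` at every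
additive `p ≥ 5`: 1 735 / 1 735).  Mutation pass over the 3 220 conductor-tie partners in the table (`N ≤ 10⁴`, `S₃`, non-CM): the
conductor-minimal law fails ONCE without an isogeny excuse — `6962e1` (`N = 2·59²`, type `IV*` at `59`, rank `0`, `Ш_an = 4`, `dim Sel₂ = 2`,
`v₂(m) = 3`, `λ₅₉ = v₂(60) = 2`: `3 + 1 < 2 + 1 + 2`), whose non-starred partner `6962l1` (type `II`, rank `1`, `dim Sel₂ = 1`) satisfies it.
Repaired census (conductor-minimal ∧ non-starred ∧ no odd isogeny ∧ `S₃` ∧ non-CM, `v₂(N) ≤ 8`): 13 995 curves, 1 045 with `Σ(λ_p − 1) + [v₃N = 2] > 0`,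
0 violations, 201 equalities (`r`-currency: 119 with `r` known, 0 violations); on the 1 223 STARRED partners: 489 charged, 1 violation (`6962e1`), 84
equalities — so the law is NOT claimed there.  Twist-invariant corollary (weaker, implied): for every conductor-minimal `W`,
`v₂(m_W) + 1 ≥ min_{W' ∈ tie(W)} dim Sel₂(W') + u₂(v₂N) + Σλ_p`. -/

/-- **ES-34U-R `MotivicEulerFactorFloorR` (this lens, -es g25 addendum; conjecture, m-currency; supersedes `MotivicEulerFactorFloor`).**
ES-34U with the representative pinned as Watkins' `p`-minimal twist: `v_p(Δ_min) < 6` (Kodaira `II`, `III` or `IV`) at every additive `p ≥ 5`.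
Census above (1 045 charged curves, 0 violations, 201 equalities).  Why it might fail: as ES-34U; and the non-starred selector may itself be a
proxy (one starred witness only) for the true Selmer term, the Bloch–Kato Selmer group of `Ad⁰` at `2`, which is twist-invariant.
[cite: Watkins2002, (1-1), Thm 2.1, Cor 2.2]
(RIDER, typer -ty g22: `@[conjecture]` as -es set it; VERBATIM; -es ADDENDUM 3 2026-08-30T04:45:19Z: confirmed OUT OF SAMPLE on all 437 226 optimal
curves `N < 10⁵` (population 159 133 decidable from the g23 table: 6 739 charged / 0 violations / 862 equalities; CensusES34 §8); the floor itself is NOT in print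
(print = Watkins's formula (1-1) / Thm 2.1, Flach prime-to-2). REF1-successor audit (REF1 g23 FINAL 04:29Z; -es: «audit the R decls, not v1») and REF2 placement owed at port time.) -/
@[conjecture] def MotivicEulerFactorFloorR : Prop :=
  ∀ (W : WeierstrassCurve ℚ) [W.IsElliptic] [W.IsGloballyMinimal] [NeZero (W.conductorNorm ℤ)]
    (D : ModularParametrizationData W (W.conductorNorm ℤ)),
    (∀ (W'' : WeierstrassCurve ℚ) [W''.IsElliptic] (D'' : ModularParametrizationData W'' (W.conductorNorm ℤ)),
        D''.f = D.f → D.modularDegree ≤ D''.modularDegree) →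
    ¬ W.HasCM → W.HasSurjectiveModNGaloisRep ((2 : ℕ) : ℤ) →
    (∀ ℓ : ℕ, ℓ.Prime → ℓ ≠ 2 → W.HasIrreducibleModPGaloisRep ℓ) → IsTwistMinimal W →
    (∀ p : ℕ, p.Prime → 5 ≤ p → p ^ 2 ∣ W.conductorNorm ℤ → (padicValRat p W.Δ).toNat < 6) →
    Nat.card (W.selmerGroup 2) *
        2 ^ (twoAdicDegreeUnit (padicValNat 2 (W.conductorNorm ℤ)) + oddUnitSum W (W.conductorNorm ℤ))
      ≤ 2 * 2 ^ padicValNat 2 D.modularDegree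

/-- **ES-34U♯-R `MotivicEulerFactorCongruenceFloorR` (conjecture, r-currency; supersedes `MotivicEulerFactorCongruenceFloor`).**
(RIDER, typer -ty g22: `@[conjecture]` as -es set it; VERBATIM; census `r`-currency 119 charged / 0 violations (ADDENDUM 2). REF1-successor audit (REF1 g23 FINAL 04:29Z; -es: «audit the R decls, not v1») and REF2 placement owed at port time.) -/
@[conjecture] def MotivicEulerFactorCongruenceFloorR : Prop :=
  ∀ (W : WeierstrassCurve ℚ) [W.IsElliptic] [W.IsGloballyMinimal] [NeZero (W.conductorNorm ℤ)]
    (D : ModularParametrizationData W (W.conductorNorm ℤ)),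
    ¬ W.HasCM → W.HasSurjectiveModNGaloisRep ((2 : ℕ) : ℤ) →
    (∀ ℓ : ℕ, ℓ.Prime → ℓ ≠ 2 → W.HasIrreducibleModPGaloisRep ℓ) → IsTwistMinimal W →
    (∀ p : ℕ, p.Prime → 5 ≤ p → p ^ 2 ∣ W.conductorNorm ℤ → (padicValRat p W.Δ).toNat < 6) →
    Nat.card (W.selmerGroup 2) *
        2 ^ (twoAdicCongruenceUnit (padicValNat 2 (W.conductorNorm ℤ)) + oddUnitSum W (W.conductorNorm ℤ))
      ≤ 2 * 2 ^ padicValNat 2 (congruenceNumber D.f)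

/-! ## ES-34V/W — the odd-twist shift: print in m-currency, new in r-currency -/

/-- The `2`-adic Watkins–Zagier shift `v₂(V_p)` of an odd prime `p` at which `W` (globally minimal) is good or multiplicative:
`v₂((p−1)(p+1−a_p)(p+1+a_p))` resp. `v₂(p²−1)`; `0` at an additive (twist-minimal) `p`.
(carrier, VERBATIM from -es g25's crux workfile `SymSquareAnatomyES34.lean` v2 9333133fa4de8611; typer -ty g22.) -/
def oddTwistShift (W : WeierstrassCurve ℚ) [W.IsGloballyMinimal] (N p : ℕ) : ℕ :=
  if p ^ 2 ∣ N then 0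
  else if p ∣ N then padicValNat 2 (p ^ 2 - 1)
  else padicValNat 2 (p - 1) + padicValNat 2 ((((p : ℤ) + 1) ^ 2 - (W.frobeniusTrace p) ^ 2).natAbs)

/-- **ES-34V `OddTwistModularDegreeShift` (IN PRINT modulo the Manin constant; m-currency).**  For optimal parametrisations of
`E` and of its twist `E ⊗ χ_{p*}` by an odd prime `p` at which `E` is `p`-twist-minimal:
`v₂(m_{E ⊗ χ}) = v₂(m_E) + v₂(V_p)`.  Watkins 2002 §2.1 (`V_p`, from Zagier 1985) with `c_E = c_{E⊗χ}`; ENGINE 34: exact on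
16 360 / 16 360 (minimal-twist, twist) pairs with `N ≤ 10⁴` (all `p ∣ D` at once, `p = 2` included with Watkins' `V₂`).
Filed as the SHAPE of the Literature fact the lens asks for; why it might fail as typed: unequal Manin constants in a pair.
[cite: Watkins2002, §2.1] [cite: Zagier1985]
(RIDER, typer -ty g22: PLAIN as -es set it (print, `m`-currency — Watkins §2.1 twist factors `V_p`; ENGINE 34 exact in `v₂(deg)` on
16 360 / 16 360 pairs); VERBATIM. REF1-successor audit (REF1 g23 FINAL 04:29Z; -es: «audit the R decls, not v1») and REF2 placement owed at port time.)
(v2 RETAG, typer -ty g22 after REF1 g24 §319 R319c/R319f, 04:53Z: `@[conjecture]` ADDED (was PLAIN).  REF1: the row SURVIVES IN DATA (17 756 oriented single-prime pairs / 0), but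
print (Watkins 2002 p. 491, §2.1) carries the Manin factor `c_E²/c_F²`: `deg φ_E = deg φ_F · (c_E²/c_F²) · ∏ V_p`, so THIS row = print ⊕ [`v₂ c_W = v₂ c_{W ⊗ p*}`] (Manin's
conjecture `c = 1` for optimal curves) — not PLAIN-grade as typed; R319f offered «either `@[conjecture]` or the Manin-displayed form»: BOTH are done — this decl is retagged (body
verbatim) and REF1's print-literal form K319.8 `OddTwistModularDegreeShiftManin` is appended next (PLAIN), with REF1's glue `Kernel.plain_iff_manin_of_eq` /
`Kernel.plain_ne_manin_of_shift` in the kernel sibling.) -/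
@[conjecture] def OddTwistModularDegreeShift : Prop :=
  ∀ (W : WeierstrassCurve ℚ) [W.IsElliptic] [W.IsGloballyMinimal] (p : ℕ)
    [(W.quadraticTwist (primeStar p : ℚ)).IsElliptic] [NeZero (W.conductorNorm ℤ)]
    [NeZero ((W.quadraticTwist (primeStar p : ℚ)).conductorNorm ℤ)]
    (D : ModularParametrizationData W (W.conductorNorm ℤ))
    (D' : ModularParametrizationData (W.quadraticTwist (primeStar p : ℚ)) ((W.quadraticTwist (primeStar p : ℚ)).conductorNorm ℤ)),
    p.Prime → p ≠ 2 →
    (∀ (W'' : WeierstrassCurve ℚ) [W''.IsElliptic] (D'' : ModularParametrizationData W'' (W.conductorNorm ℤ)),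
        D''.f = D.f → D.modularDegree ≤ D''.modularDegree) →
    (∀ (W'' : WeierstrassCurve ℚ) [W''.IsElliptic]
        (D'' : ModularParametrizationData W'' ((W.quadraticTwist (primeStar p : ℚ)).conductorNorm ℤ)),
        D''.f = D'.f → D'.modularDegree ≤ D''.modularDegree) →
    W.conductorNorm ℤ ≤ (W.quadraticTwist (primeStar p : ℚ)).conductorNorm ℤ →
    padicValNat 2 D'.modularDegree = padicValNat 2 D.modularDegree + oddTwistShift W (W.conductorNorm ℤ) p

/-- K319.8: the Manin-displayed (print-literal) form of ES-34V — Watkins 2002 §2.1: `deg φ_E = deg φ_F · (c_E²/c_F²) · ∏_p V_p`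
for `F` the minimal twist; as typed (`D` for the `p`-minimal `W`, `D'` for `W ⊗ χ_{p*}`) the literal identity is
`v₂(m') + 2 v₂(c) = v₂(m) + 2 v₂(c') + v₂(V_p)`; the PLAIN row drops `2 v₂(c') − 2 v₂(c)` (true iff the two Manin constants have
the same 2-adic valuation — Manin's conjecture `c = 1` for optimal curves; R319c). This Prop elaborates:
(RIDER, typer -ty g22, v2: REF1 g24's print-literal form of ES-34V (R319c/R319f option «display `c`»), VERBATIM from `REF1-data/b319/Probe319.lean` 218d7a06bd7a7aaf (REF1's
docstring above kept), filed PLAIN under REF1's name in -es's namespace next to the retagged `OddTwistModularDegreeShift`: Watkins 2002 §2.1 with the Manin constants displayed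
(`ModularParametrizationData.c`), i.e. print-assembly grade modulo the tree's modularity/Manin vocabulary; glue both ways under `v₂ c = v₂ c'` and the contradiction under
`v₂ c' = v₂ c + 1` are `Kernel.REF1_319.plain_iff_manin_of_eq` / `plain_ne_manin_of_shift`.  REF2 placement owed.  Nothing asserted; BSD not proved.)
[cite: Watkins2002, §2.1] [cite: Zagier1985] -/
def OddTwistModularDegreeShiftManin : Prop :=
  ∀ (W : WeierstrassCurve ℚ) [W.IsElliptic] [W.IsGloballyMinimal] (p : ℕ)
    [(W.quadraticTwist (primeStar p : ℚ)).IsElliptic] [NeZero (W.conductorNorm ℤ)]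
    [NeZero ((W.quadraticTwist (primeStar p : ℚ)).conductorNorm ℤ)]
    (D : ModularParametrizationData W (W.conductorNorm ℤ))
    (D' : ModularParametrizationData (W.quadraticTwist (primeStar p : ℚ)) ((W.quadraticTwist (primeStar p : ℚ)).conductorNorm ℤ)),
    p.Prime → p ≠ 2 →
    (∀ (W'' : WeierstrassCurve ℚ) [W''.IsElliptic] (D'' : ModularParametrizationData W'' (W.conductorNorm ℤ)),
        D''.f = D.f → D.modularDegree ≤ D''.modularDegree) →
    (∀ (W'' : WeierstrassCurve ℚ) [W''.IsElliptic]
        (D'' : ModularParametrizationData W'' ((W.quadraticTwist (primeStar p : ℚ)).conductorNorm ℤ)),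
        D''.f = D'.f → D'.modularDegree ≤ D''.modularDegree) →
    W.conductorNorm ℤ ≤ (W.quadraticTwist (primeStar p : ℚ)).conductorNorm ℤ →
    padicValNat 2 D'.modularDegree + 2 * padicValInt 2 D.c =
      padicValNat 2 D.modularDegree + 2 * padicValInt 2 D'.c + oddTwistShift W (W.conductorNorm ℤ) p

/-- **ES-34W `OddTwistCongruenceNumberShift` (this lens, -es g25; conjecture beyond print, r-currency).**  For a non-CM `E/ℚ`
with `ρ̄_{E,2}` surjective and `v₂(N) ≠ 2`, and an odd prime `p` at which `E` is `p`-twist-minimal, the congruence numbers of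
`f_E` and `f_{E ⊗ χ_{p*}}` satisfy `v₂(r_{E⊗χ}) = v₂(r_E) + v₂(V_p)` — Wiles' level-raising factor
`c_p = (p−1)(p+1−a_p)(p+1+a_p)` governs the congruence module at `ℓ = 2` EXACTLY; equivalently the Agashe–Ribet–Stein defect
`v₂(r/m)` is an invariant of the odd-twist class.  ENGINE 34: 838 `S₃` pairs with both `r` known — 831 exact, the 7 exceptions
are exactly the pairs at `v₂(N) = 2` whose minimal member is an ES-33C dip and whose twist is not (`2300b1/92b1`, `1116e1/124a1`,
`1044e1/348a1`, …); at `v₂(N) ∈ {0,1,3,5,7,8}`: 728 / 728.  Outside the `S₃` frame it fails (`1152p1/384a1`, Borel image, `v = 7`).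
Why it might fail: a multiplicity-one failure of `𝕋_𝔪` at `2` away from `4 ∥ N` (none seen `N ≤ 10⁴`), where Ihara's lemma
gives only `≥`. [cite: Watkins2002, §2.1] [cite: deShalit1997, p. 435 Lemma 4.4 + §4.3 (`η_Σ' ⊂ c_p η_Σ`, `ℓ` odd)] [cite: AgasheRibetStein2012]
(RIDER, typer -ty g22: `@[conjecture]` as -es set it (new in `r`-currency, not in print); VERBATIM. REF1-successor audit (REF1 g23 FINAL 04:29Z; -es: «audit the R decls, not v1») and REF2 placement owed at port time.) -/
@[conjecture] def OddTwistCongruenceNumberShift : Prop :=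
  ∀ (W : WeierstrassCurve ℚ) [W.IsElliptic] [W.IsGloballyMinimal] (p : ℕ)
    [(W.quadraticTwist (primeStar p : ℚ)).IsElliptic] [NeZero (W.conductorNorm ℤ)]
    [NeZero ((W.quadraticTwist (primeStar p : ℚ)).conductorNorm ℤ)]
    (D : ModularParametrizationData W (W.conductorNorm ℤ))
    (D' : ModularParametrizationData (W.quadraticTwist (primeStar p : ℚ)) ((W.quadraticTwist (primeStar p : ℚ)).conductorNorm ℤ)),
    p.Prime → p ≠ 2 → ¬ W.HasCM → W.HasSurjectiveModNGaloisRep ((2 : ℕ) : ℤ) →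
    padicValNat 2 (W.conductorNorm ℤ) ≠ 2 →
    W.conductorNorm ℤ ≤ (W.quadraticTwist (primeStar p : ℚ)).conductorNorm ℤ →
    padicValNat 2 (congruenceNumber D'.f) = padicValNat 2 (congruenceNumber D.f) + oddTwistShift W (W.conductorNorm ℤ) p

/-! ## ES-34T — the Agashe–Ribet–Stein defect of the 2-adic twists of semistable curves (conjecture; exact rows) -/

/-- **ES-34T `ARSDefectOfSemistableTwistAtSixteen` (this lens, -es g25; conjecture).**  If `E` is optimal with `2⁴ ∥ N_E` and
its twist by `−1` has conductor not divisible by `4` (i.e. `E = F ⊗ χ₋₄` with `F` good or multiplicative at `2`), then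
`v₂(r_E) = v₂(m_E) + 1` — the ARS defect is EXACTLY `1` (ARS allow `0 … 2`).  ENGINE 34: every such curve with `r` known,
`N ≤ 10⁴` (`F` good at `2`: 49 / 49; `F` multiplicative at `2`: 183 / 183, every image type).  Companion rows (not typed):
`2⁶ ∥ N`, `F` multiplicative: defect `2` (38 / 38); `F` good: defect `3` (4 / 4).
Why it might fail: a curve `2⁴ ∥ N` twisted from a semistable one with `𝕋` Gorenstein-defect `≠ 1` at `2` beyond `10⁴`.
[cite: AgasheRibetStein2012, Thm 2.1 + Conj.] [cite: Watkins2002, §2.1.1]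
(RIDER, typer -ty g22: `@[conjecture]` as -es set it; VERBATIM. REF1-successor audit (REF1 g23 FINAL 04:29Z; -es: «audit the R decls, not v1») and REF2 placement owed at port time.) -/
@[conjecture] def ARSDefectOfSemistableTwistAtSixteen : Prop :=
  ∀ (W : WeierstrassCurve ℚ) [W.IsElliptic] [W.IsGloballyMinimal] [NeZero (W.conductorNorm ℤ)]
    [(W.quadraticTwist (-1 : ℚ)).IsElliptic]
    (D : ModularParametrizationData W (W.conductorNorm ℤ)),
    (∀ (W'' : WeierstrassCurve ℚ) [W''.IsElliptic] (D'' : ModularParametrizationData W'' (W.conductorNorm ℤ)),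
        D''.f = D.f → D.modularDegree ≤ D''.modularDegree) →
    padicValNat 2 (W.conductorNorm ℤ) = 4 → ¬ 4 ∣ (W.quadraticTwist (-1 : ℚ)).conductorNorm ℤ →
    padicValNat 2 (congruenceNumber D.f) = padicValNat 2 D.modularDegree + 1

/-! ## Glue (kernel-checked bookkeeping) -/

end Summit.BirchSwinnertonDyer.BirchSwinnertonDyer.Theorems.RankOneAtTwoSymSquareAnatomy
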